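import Summits.QuantumAdvantage.QuantumAdvantage.Theorems.CubicForrelationNearExactIsExactTypeE8
import Summits.QuantumAdvantage.QuantumAdvantage.Theorems.CubicForrelationNearExactIsExactCubicEvenOnFourFlat
import Literature.Computability.QuantumComplexity.ForrelationMSubspaceDuality
import Literature.Computability.QuantumComplexity.SignedCubicForrelation

/-!
# Crux `CubicForrelation.NearExactIsExact` (stmt-QuantumAdvantage-14043) — FLAT SUMS of `W_g/8` on 8 bits

Certificate seat `b2b-cforr-cert` (generation 2), rung `θ₈ = 13/16`.  HONEST FRAMING: theorems about cubic Boolean functions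
on 8 bits (the finite slice `n = 8` of the crux) — NOT summit progress.

For a CUBIC `g : 𝔽₂⁸ → 𝔽₂` write `W_g = 8·u` (Ax).  PARAMETRISED 4-FLATS: for a base point `b` and four directions `a₀,…,a₃`
(NO independence assumed; sums run over the `16` parameters `ε ∈ 𝔽₂⁴` with multiplicity) the points are `b ⊕ ⊕_{εᵢ=1} aᵢ`,
written coordinatewise `b_j ⊕ [#{i : εᵢ ∧ a_{ij}} odd]`.
* `ed_flat_sum_four`: `Σ_ε u(b ⊕ a_ε) ≡ 0 (mod 8)`.  Proof: the characters sum to `Σ_ε (−1)^{(b⊕a_ε)·y} = 16·(−1)^{b·y}·[y ∈ T]`,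
  `T = {y : aᵢ·y = 0 ∀ i}` (`ed_sum_twist_flat`), so `Σ_ε W_g(b ⊕ a_ε) = 16·Σ_{y∈T} (−1)^{g(y) ⊕ b·y}` (`ed_sum_W_flat`);
  `16 ∣ |T|` (`ed_card_annihilator`: `T ∋ 0` is `⊕`-closed, `|T|·|T^⊥| = 2⁸` by the landed `card_mul_card_perp`, and `|T| ≥ 16`
  because a fibre of `y ↦ (aᵢ·y)ᵢ` with `≥ 16` points translates injectively into `T`); and `#{y ∈ T : g(y) ⊕ b·y = 1}` is EVEN
  (`ed_even_card_annihilator`: `y ↦ (g(y) ⊕ b·y) ∧ Π_i ¬(aᵢ·y)` has degree `≤ 3 + 4 = 7 < 8`, Ax with `d = 7` on the full cube).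
  Hence `8·Σ_ε u = 16·(|T| − 2·even) ∈ 64ℤ`.
* `ed_even_card_flat` / `ed_sum_signOf_flat`: a cubic `F` on 8 bits is even on every parametrised 4-flat,
  `Σ_ε (−1)^{F(b ⊕ a_ε)} ∈ 4ℤ` (the landed `cf_even_card_of_cubic_four` after the affine pullback `ed_deg_pullback`; the landed
  `stub_cubicEvenOnFourFlat` is the 9-bit instance).
Numerical sanity check (seat folder `work/c/check8.c`): all sampled 4-flat sums of `u` are `≡ 0 (mod 8)`.

References: J. Ax, Amer. J. Math. 86 (1964); C. Carlet, *Boolean Functions for Cryptography and Coding Theory*, CUP 2021, §2.2,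
§4.1; R. O'Donnell, *Analysis of Boolean Functions*, CUP 2014, §3.3 (characters and annihilators of subspaces).  Everything below
is proved from Mathlib and the tree; axioms are the standard three.
-/

set_option linter.dupNamespace false -- D-0017: single-problem summit ⇒ `QuantumAdvantage.QuantumAdvantage` by design

noncomputable section

namespace Summit.QuantumAdvantage.QuantumAdvantage.Theorems.CubicForrelation.NearExactIsExact

open Finset
open Literature.Computability.QuantumComplexity
open Literature.Computability.QuantumComplexity.BuzetChailloux (bxor zeroVec bxor_bxor_cancel_left twist_zeroVec_right
  twist_bxor_right)
open Literature.Computability.QuantumComplexity.DerivativeWalsh (W twist_bxor_left card_mul_card_perp)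
open Summit.QuantumAdvantage.QuantumAdvantage.Theorems.SignedCubicForrelationNotPrBPP (knf_isDegLeFun_ip
  knf_isDegLeFun_comp)

/-! ### Parametrised 4-flats: the character sum and the flat sums of `u` -/

/-- `[m + 1 odd] = ¬[m odd]`. [folklore] -/
theorem ed_decide_odd_succ (m : ℕ) : decide (Odd (m + 1)) = !decide (Odd m) := by
  by_cases h : Odd m
  · have h' : ¬ Odd (m + 1) := fun h1 => by rw [Nat.odd_add_one] at h1; exact h1 h
    rw [decide_eq_true h, decide_eq_false h']; rfl
  · have h' : Odd (m + 1) := Nat.odd_add_one.2 h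
    rw [decide_eq_false h, decide_eq_true h']; rfl


/-- The point `b ⊕ ⊕_{εᵢ = 1} aᵢ` of the parametrised flat, coordinatewise: `b_j ⊕ [#{i : εᵢ ∧ a_{ij}} odd]`; its character
against `y` factors as `(−1)^{b·y} · Π_i (εᵢ ? (−1)^{aᵢ·y} : 1)`. [cite: ODonnell2014, §3.3] -/
theorem ed_twist_flatPt {k n : ℕ} (b : Fin n → Bool) (a : Fin k → Fin n → Bool) (ε : Fin k → Bool) (y : Fin n → Bool) :
    twist (fun j => b j ^^ decide (Odd #(univ.filter fun i => ε i && a i j))) y =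
      twist b y * ∏ i, (if ε i then twist (a i) y else 1) := by
  classical
  -- induction on the set of active directions via the `bxor` description
  have key : ∀ (s : Finset (Fin k)),
      twist (fun j => b j ^^ decide (Odd #(s.filter fun i => ε i && a i j))) y =
        twist b y * ∏ i ∈ s, (if ε i then twist (a i) y else 1) := by
    intro s
    induction s using Finset.induction_on with
    | empty =>
      simp only [filter_empty, card_empty, Nat.odd_iff, Nat.zero_mod, zero_ne_one, decide_false, Bool.xor_false,
        prod_empty, mul_one]
    | insert i₀ s hi₀ ih =>
      rw [prod_insert hi₀]
      have hcard : ∀ j0 : Fin n, #((insert i₀ s).filter fun i => ε i && a i j0) =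
          #(s.filter fun i => ε i && a i j0) + (if (ε i₀ && a i₀ j0) = true then 1 else 0) := by
        intro j0
        rw [filter_insert]
        split_ifs with h
        · rw [card_insert_of_notMem (fun hm => hi₀ (mem_filter.1 hm).1)]
        · rfl
      have hpt : (fun j => b j ^^ decide (Odd #((insert i₀ s).filter fun i => ε i && a i j))) =
          bxor (fun j => ε i₀ && a i₀ j) (fun j => b j ^^ decide (Odd #(s.filter fun i => ε i && a i j))) := by
        funext j
        show (b j ^^ decide (Odd #((insert i₀ s).filter fun i => ε i && a i j))) =
          ((ε i₀ && a i₀ j) ^^ (b j ^^ decide (Odd #(s.filter fun i => ε i && a i j))))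
        rw [hcard j]
        generalize #(s.filter fun i => ε i && a i j) = m
        cases hε : (ε i₀ && a i₀ j)
        · simp
        · simp only [if_true, ed_decide_odd_succ, Bool.true_xor]
          cases b j <;> cases decide (Odd m) <;> rfl
      rw [hpt, twist_bxor_left, ih]
      have hfac : twist (fun j => ε i₀ && a i₀ j) y = if ε i₀ then twist (a i₀) y else 1 := by
        cases h : ε i₀
        · simp only [Bool.false_and]
          rw [show (fun _ : Fin n => false) = (zeroVec : Fin n → Bool) from rfl, twist_comm, twist_zeroVec_right]
          simp
        · simp only [Bool.true_and, if_true]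
      rw [hfac]
      ring
  simpa only [filter_univ_mem] using key univ

/-- **Character sum over a parametrised 4-flat.** `Σ_ε (−1)^{(b ⊕ a_ε)·y} = (−1)^{b·y}·16` if `y` annihilates every `aᵢ`
and `0` otherwise. [cite: ODonnell2014, §3.3] -/
theorem ed_sum_twist_flat {n : ℕ} (b : Fin n → Bool) (a : Fin 4 → Fin n → Bool) (y : Fin n → Bool) :
    ∑ ε : Fin 4 → Bool, twist (fun j => b j ^^ decide (Odd #(univ.filter fun i => ε i && a i j))) y =
      if (∀ i, twist (a i) y = 1) then 16 * twist b y else 0 := by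
  classical
  simp_rw [ed_twist_flatPt]
  rw [← mul_sum, ← Fintype.prod_sum (fun i (e : Bool) => if e then twist (a i) y else (1 : ℝ))]
  have hb : ∀ i, ∑ e : Bool, (if e then twist (a i) y else (1 : ℝ)) = twist (a i) y + 1 := by
    intro i
    rw [Fintype.sum_bool]
    simp
  simp_rw [hb]
  split_ifs with hall
  · rw [prod_congr rfl fun i _ => show twist (a i) y + 1 = 2 by rw [hall i]; norm_num, prod_const, card_univ,
      Fintype.card_fin]
    norm_num [mul_comm]
  · push Not at hall
    obtain ⟨i, hi⟩ := hall
    have hneg : twist (a i) y = -1 := (Simon.twist_eq_one_or (a i) y).resolve_left hi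
    rw [prod_eq_zero (mem_univ i) (by rw [hneg]; norm_num), mul_zero]

/-- Walsh values summed over a parametrised 4-flat: `Σ_ε W_G(b ⊕ a_ε) = 16·Σ_{y : aᵢ·y = 0 ∀i} G(y)(−1)^{b·y}` for every real
`G`. [cite: ODonnell2014, §3.3] -/
theorem ed_sum_W_flat {n : ℕ} (G : (Fin n → Bool) → ℝ) (b : Fin n → Bool) (a : Fin 4 → Fin n → Bool) :
    ∑ ε : Fin 4 → Bool, W G (fun j => b j ^^ decide (Odd #(univ.filter fun i => ε i && a i j))) =
      16 * ∑ y ∈ univ.filter (fun y => ∀ i, twist (a i) y = 1), G y * twist b y := by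
  classical
  unfold W
  rw [sum_comm]
  simp_rw [← mul_sum]
  rw [mul_sum, ← sum_filter_add_sum_filter_not univ (fun y : Fin n → Bool => ∀ i, twist (a i) y = 1)]
  have h1 : ∑ y ∈ univ.filter (fun y => ∀ i, twist (a i) y = 1),
      G y * ∑ ε : Fin 4 → Bool, twist y (fun j => b j ^^ decide (Odd #(univ.filter fun i => ε i && a i j))) =
      ∑ y ∈ univ.filter (fun y => ∀ i, twist (a i) y = 1), 16 * (G y * twist b y) := by
    refine sum_congr rfl fun y hy => ?_
    simp_rw [twist_comm y]
    rw [ed_sum_twist_flat, if_pos (mem_filter.1 hy).2]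
    ring
  have h2 : ∑ y ∈ univ.filter (fun y => ¬ ∀ i, twist (a i) y = 1),
      G y * ∑ ε : Fin 4 → Bool, twist y (fun j => b j ^^ decide (Odd #(univ.filter fun i => ε i && a i j))) = 0 := by
    refine sum_eq_zero fun y hy => ?_
    simp_rw [twist_comm y]
    rw [ed_sum_twist_flat, if_neg (mem_filter.1 hy).2, mul_zero]
  rw [h1, h2, add_zero]

/-- The annihilator `T = {y : aᵢ·y = 0 ∀ i < 4}` of four directions in `𝔽₂⁸` has size divisible by `16`: the `⊕`-closed set
`U` of the `16` sums `a_ε` satisfies `|U|·|U^⊥| = 2⁸` (`card_mul_card_perp`) with `|U| ≤ 16` and `U^⊥ = T`. [cite: ODonnell2014, §3.3] -/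
theorem ed_card_annihilator (a : Fin 4 → Fin (4 + 4) → Bool) :
    16 ∣ #(univ.filter fun y : Fin (4 + 4) → Bool => ∀ i, twist (a i) y = 1) := by
  classical
  set T : Finset (Fin (4 + 4) → Bool) := univ.filter fun y : Fin (4 + 4) → Bool => ∀ i, twist (a i) y = 1 with hT
  -- `T ∋ 0` is closed under `⊕`
  have h0 : zeroVec ∈ T := mem_filter.2 ⟨mem_univ _, fun i => twist_zeroVec_right (a i)⟩
  have hadd : ∀ x ∈ T, ∀ x' ∈ T, bxor x x' ∈ T := by
    intro x hx x' hx'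
    refine mem_filter.2 ⟨mem_univ _, fun i => ?_⟩
    rw [twist_bxor_right, (mem_filter.1 hx).2 i, (mem_filter.1 hx').2 i, one_mul]
  -- `|T| · |T^⊥| = 256`
  have hcard := card_mul_card_perp h0 hadd
  have hnat : #T * #(univ.filter fun y : Fin (4 + 4) → Bool => ∀ x ∈ T, twist x y = 1) = 256 := by
    exact_mod_cast hcard
  -- `|T| ≥ 16`: a fibre of `y ↦ (aᵢ·y)_i` with `≥ 16` points translates into `T`
  have hbig : ∃ c : Fin 4 → Bool, 15 < #(univ.filter fun y : Fin (4 + 4) → Bool =>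
      (fun i => decide (Odd #(univ.filter fun l => a i l && y l))) = c) :=
    Fintype.exists_lt_card_fiber_of_mul_lt_card (fun (y : Fin (4 + 4) → Bool) (i : Fin 4) =>
      decide (Odd #(univ.filter fun l => a i l && y l))) (by simp)
  obtain ⟨c, hc⟩ := hbig
  set F := univ.filter fun y : Fin (4 + 4) → Bool =>
    (fun i => decide (Odd #(univ.filter fun l => a i l && y l))) = c with hF
  obtain ⟨y₀, hy₀⟩ : F.Nonempty := card_pos.1 (by omega)
  have hinj : Set.InjOn (fun y => bxor y₀ y) F := fun y _ y' _ h => by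
    simpa only [bxor_bxor_cancel_left] using congrArg (bxor y₀) h
  have hmaps : ∀ y ∈ F, bxor y₀ y ∈ T := by
    intro y hy
    have hyc := (mem_filter.1 hy).2
    have hy0c := (mem_filter.1 hy₀).2
    refine mem_filter.2 ⟨mem_univ _, fun i => ?_⟩
    rw [twist_bxor_right, vg_twist_eq_signOf, vg_twist_eq_signOf, congrFun hy0c i, congrFun hyc i]
    unfold signOf; split_ifs <;> norm_num
  have h16 : 16 ≤ #T := by
    calc 16 ≤ #F := by omega
      _ = #(F.image fun y => bxor y₀ y) := (card_image_of_injOn hinj).symm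
      _ ≤ #T := card_le_card (image_subset_iff.2 hmaps)
  have hle : #T ≤ 256 := by
    calc #T ≤ #(univ : Finset (Fin (4 + 4) → Bool)) := card_le_univ T
      _ = 256 := by simp
  generalize #T = p at hnat h16 hle
  generalize #(univ.filter fun y : Fin (4 + 4) → Bool => ∀ x ∈ T, twist x y = 1) = q at hnat
  have hq : q ≤ 16 := by nlinarith
  interval_cases q <;> omega

/-- `(p ∧ q) = true ↔ p = true ∧ q = true` on Booleans (top-level use only). [folklore] -/
theorem ed_band_true {p q : Bool} : (p && q) = true ↔ p = true ∧ q = true := by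
  cases p <;> cases q <;> simp

/-- On the annihilator of four directions a cubic-plus-affine function has an EVEN number of ones:
`y ↦ (h(y) ⊕ [b·y odd]) ∧ Π_i ¬[aᵢ·y odd]` has degree `≤ 7 < 8`, so Ax on the full cube makes its weight even. [cite: Carlet2020, §4.1] -/
theorem ed_even_card_annihilator (h : (Fin (4 + 4) → Bool) → Bool) (hh : IsDegLeFun 3 h) (b : Fin (4 + 4) → Bool)
    (a : Fin 4 → Fin (4 + 4) → Bool) :
    Even #(univ.filter fun y : Fin (4 + 4) → Bool => (∀ i, twist (a i) y = 1) ∧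
      (h y ^^ decide (Odd #(univ.filter fun l => b l && y l))) = true) := by
  classical
  -- the product function of degree ≤ 7
  set H : (Fin (4 + 4) → Bool) → Bool := fun y =>
    ((((h y ^^ decide (Odd #(univ.filter fun l => y l && b l))) &&
      !decide (Odd #(univ.filter fun l => y l && a 0 l))) &&
      !decide (Odd #(univ.filter fun l => y l && a 1 l))) &&
      !decide (Odd #(univ.filter fun l => y l && a 2 l))) &&
      !decide (Odd #(univ.filter fun l => y l && a 3 l)) with hH
  have hdeg : IsDegLeFun 7 H := by
    have h1 : IsDegLeFun 3 (fun y => h y ^^ decide (Odd #(univ.filter fun l => y l && b l))) :=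
      bb_isDegLeFun_bxor hh ((knf_isDegLeFun_ip b).mono (by norm_num))
    have hn : ∀ c : Fin (4 + 4) → Bool, IsDegLeFun 1 (fun y => !decide (Odd #(univ.filter fun l => y l && c l))) :=
      fun c => (knf_isDegLeFun_ip c).not
    exact (te_isDegLeFun_band (te_isDegLeFun_band (te_isDegLeFun_band (te_isDegLeFun_band h1 (hn (a 0))) (hn (a 1)))
      (hn (a 2))) (hn (a 3))).mono (by norm_num)
  obtain ⟨z, hz⟩ := stub_axParity (4 + 4) 7 H univ (by norm_num) hdeg
  rw [filter_true_of_mem (fun u _ i _ => mem_univ i), show (#(univ : Finset (Fin (4 + 4))) + 7 - 1) / 7 = 2 by simp,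
    fc_sum_signOf_eq_card] at hz
  -- identify the two filters
  have htw : ∀ (c y0 : Fin (4 + 4) → Bool), twist c y0 = 1 ↔
      (!decide (Odd #(univ.filter fun l => y0 l && c l))) = true := by
    intro c y0
    rw [twist_comm, vg_twist_eq_signOf]
    cases decide (Odd #(univ.filter fun l => y0 l && c l)) <;> norm_num [signOf]
  have hfil : (univ.filter fun y : Fin (4 + 4) → Bool => H y = true) = univ.filter fun y : Fin (4 + 4) → Bool =>
      (∀ i, twist (a i) y = 1) ∧ (h y ^^ decide (Odd #(univ.filter fun l => b l && y l))) = true := by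
    ext y
    simp only [mem_filter, mem_univ, true_and]
    have hbc : (univ.filter fun l => b l && y l) = univ.filter fun l => y l && b l := by
      congr 1; funext l; rw [Bool.and_comm]
    rw [hbc]
    constructor
    · intro hH'
      obtain ⟨h012, h3⟩ := ed_band_true.1 hH'
      obtain ⟨h01, h2⟩ := ed_band_true.1 h012
      obtain ⟨h0, h1⟩ := ed_band_true.1 h01
      obtain ⟨hx, h0⟩ := ed_band_true.1 h0
      refine ⟨fun i => ?_, hx⟩
      fin_cases i
      · exact (htw (a 0) y).2 h0
      · exact (htw (a 1) y).2 h1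
      · exact (htw (a 2) y).2 h2
      · exact (htw (a 3) y).2 h3
    · rintro ⟨hall, hx⟩
      exact ed_band_true.2 ⟨ed_band_true.2 ⟨ed_band_true.2 ⟨ed_band_true.2 ⟨hx, (htw (a 0) y).1 (hall 0)⟩,
        (htw (a 1) y).1 (hall 1)⟩, (htw (a 2) y).1 (hall 2)⟩, (htw (a 3) y).1 (hall 3)⟩
  rw [← hfil]
  have hc : ((#(univ.filter fun y : Fin (4 + 4) → Bool => H y = true) : ℤ) : ℝ) = ((2 * (64 - z) : ℤ) : ℝ) := by
    push_cast
    norm_num at hz ⊢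
    linarith
  have he : Even ((#(univ.filter fun y : Fin (4 + 4) → Bool => H y = true) : ℤ)) :=
    ⟨64 - z, by rw [Int.cast_injective hc]; ring⟩
  exact (Int.even_coe_nat _).mp he

/-- **Flat sums of `u = W_g/8` (n = 8).** For cubic `g` with `W_g = 8·u`, every point `b` and every four directions
`a₀,…,a₃`: `Σ_{ε ∈ 𝔽₂⁴} u(b ⊕ ⊕_{εᵢ=1} aᵢ) ≡ 0 (mod 8)` (sum with multiplicity; no independence assumed). [this work] -/
theorem ed_flat_sum_four (g : (Fin (4 + 4) → Bool) → Bool) (u : (Fin (4 + 4) → Bool) → ℤ) (hg : IsDegLeFun 3 g)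
    (hu : ∀ x, W (fun y => signOf (g y)) x = (2 : ℝ) ^ 3 * (u x : ℝ)) (b : Fin (4 + 4) → Bool)
    (a : Fin 4 → Fin (4 + 4) → Bool) :
    (8 : ℤ) ∣ ∑ ε : Fin 4 → Bool, u (fun j => b j ^^ decide (Odd #(univ.filter fun i => ε i && a i j))) := by
  classical
  have hW := ed_sum_W_flat (fun y => signOf (g y)) b a
  simp_rw [hu] at hW
  rw [← mul_sum] at hW
  -- the twisted sum over the annihilator is `|T| − 2·#{ones}`
  have hsg : ∀ y : Fin (4 + 4) → Bool, signOf (g y) * twist b y =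
      signOf (g y ^^ decide (Odd #(univ.filter fun l => b l && y l))) := by
    intro y
    rw [vg_twist_eq_signOf, ← signOf_xor]
  simp_rw [hsg] at hW
  rw [bb_sum_signOf] at hW
  obtain ⟨t, ht⟩ := ed_card_annihilator a
  obtain ⟨w, hw⟩ := ed_even_card_annihilator g hg b a
  rw [hw, ht] at hW
  push_cast at hW
  refine ⟨4 * t - w, ?_⟩
  have h' : ((∑ ε : Fin 4 → Bool, u (fun j => b j ^^ decide (Odd #(univ.filter fun i => ε i && a i j))) : ℤ) : ℝ) =
      ((8 * (4 * t - w) : ℤ) : ℝ) := by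
    push_cast
    linarith
  exact_mod_cast h'

/-! ### Parametrised 4-flats of a cubic on 8 bits -/

/-- The pullback of a cubic on 8 bits along an affine parametrisation `ε ↦ b ⊕ ⊕_{εᵢ=1} aᵢ` is a cubic on 4 bits.
[cite: Carlet2020, §2.2.1 Def. 6] -/
theorem ed_deg_pullback (F : (Fin (4 + 4) → Bool) → Bool) (hF : IsDegLeFun 3 F) (b : Fin (4 + 4) → Bool)
    (a : Fin 4 → Fin (4 + 4) → Bool) :
    IsDegLeFun 3 (fun ε : Fin 4 → Bool => F (fun j => b j ^^ decide (Odd #(univ.filter fun i => ε i && a i j)))) :=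
  knf_isDegLeFun_comp hF _ fun j => bb_isDegLeFun_bxor (isDegLeFun_const 1 (b j)) (knf_isDegLeFun_ip fun i => a i j)

/-- **A cubic is even on every parametrised 4-flat** (n = 8): `#{ε ∈ 𝔽₂⁴ : F(b ⊕ a_ε) = 1}` is even — the fourth derivative of a
cubic vanishes. [cite: Carlet2020, §4.1] -/
theorem ed_even_card_flat (F : (Fin (4 + 4) → Bool) → Bool) (hF : IsDegLeFun 3 F) (b : Fin (4 + 4) → Bool)
    (a : Fin 4 → Fin (4 + 4) → Bool) :
    Even #(univ.filter fun ε : Fin 4 → Bool =>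
      F (fun j => b j ^^ decide (Odd #(univ.filter fun i => ε i && a i j))) = true) :=
  cf_even_card_of_cubic_four (ed_deg_pullback F hF b a)

/-- Sign form: `Σ_{ε ∈ 𝔽₂⁴} (−1)^{F(b ⊕ a_ε)} ∈ 4ℤ` for cubic `F` on 8 bits. [cite: Carlet2020, §4.1] -/
theorem ed_sum_signOf_flat (F : (Fin (4 + 4) → Bool) → Bool) (hF : IsDegLeFun 3 F) (b : Fin (4 + 4) → Bool)
    (a : Fin 4 → Fin (4 + 4) → Bool) :
    ∃ z : ℤ, ∑ ε : Fin 4 → Bool, signOf (F (fun j => b j ^^ decide (Odd #(univ.filter fun i => ε i && a i j)))) =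
      4 * (z : ℝ) := by
  obtain ⟨w, hw⟩ := ed_even_card_flat F hF b a
  have hs := bb_sum_signOf (fun _ : Fin 4 → Bool => True)
    (fun ε => F (fun j => b j ^^ decide (Odd #(univ.filter fun i => ε i && a i j))))
  simp only [filter_true_of_mem (fun (ε : Fin 4 → Bool) (_ : ε ∈ univ) => trivial), true_and] at hs
  rw [card_univ, Fintype.card_fun, Fintype.card_bool, Fintype.card_fin] at hs
  refine ⟨4 - w, ?_⟩
  rw [hs, hw]
  push_cast
  ring

end Summit.QuantumAdvantage.QuantumAdvantage.Theorems.CubicForrelation.NearExactIsExact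

end
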